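import Literature.Probability.LatticeModels.SRWPathSpace
import Mathlib.Probability.Independence.Integration
import Mathlib.Probability.Distributions.Exponential
import HarnessLib

/-!
# The site process of the continuous-time weakly self-avoiding walk: i.i.d. sites carrying a
# uniform step and an exponential sojourn time

Probability space behind the block-decoupling bound on the critical value of the four-dimensional
weakly self-avoiding walk (Bauerschmidt–Brydges–Slade 2015, Theorem 1.2, upper inequality;
`Literature.Barriers.CriticalPhenomena.CTWSAW.BBS2015_thm12_upper`). In the time-integrated
("grand-canonical") representation of the susceptibility the skeleton is a sequence of i.i.d.
uniform steps and the sojourn times are free with weight `e^{-λ Σ σ}`, `λ = 2d + ν`; normalising,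
site `i ∈ ℕ` carries an independent pair `(step out of vertex i, sojourn at vertex i)` with law
`unif(Dir d) ⊗ Exp(λ)`. This file sets up that process:

* `sojLaw λ := ProbabilityTheory.expMeasure λ` — Mathlib's exponential law under a local name
  (`sojLaw_eq_expMeasure` is `rfl`), a probability measure for `λ > 0` (`[Fact (0 < λ)]`,
  Mathlib's `isProbabilityMeasure_expMeasure`); `sojLaw_eq_withDensity` / `lintegral_sojLaw`
  rewrite it as the density `sojDensity λ u = λe^{-λu}` on `(0,∞)`, the form in which every
  computation below is carried out; `siteLaw d λ = stepLaw d ⊗ sojLaw λ`; `configLaw d λ` —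
  their product over `ℕ` (`Measure.infinitePi`) on `Config d = ℕ → Dir d × ℝ`;
* the coordinate processes `dirs` (an `SRW.PathSpace`), `soj`;
* **projections**: `configLaw_map_restrict` (the first `m` sites are `Measure.pi` of site laws),
  `configLaw_map_dirs` (the directions form the simple random walk `SRW.pathLaw`);
* **shift invariance** `lintegral_comp_shift` (`Measure.map_infinitePi_infinitePi_of_inj`);
* **independence of disjoint blocks** `lintegral_mul_eq_of_dependsOn` (from
  `ProbabilityTheory.iIndepFun_infinitePi`);
* almost sure positivity of the sojourns `ae_forall_soj_pos`;
* the one-dimensional exponential integrals `lintegral_sojDensity`, `sojLaw_Iic_zero`.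

All folklore and fully proved.
-/

noncomputable section

open MeasureTheory ProbabilityTheory Set Filter Literature.Probability.LatticeModels
open scoped ENNReal

namespace Literature.Barriers.CriticalPhenomena.CTWSAW

variable {d : ℕ} {lam : ℝ}

/-! ### The exponential sojourn law -/

/-- The density `λ e^{-λu}` (as an `ℝ≥0∞`-valued function): the integrand abbreviation used in
`lintegral_sojLaw`; it agrees with Mathlib's `ProbabilityTheory.exponentialPDF λ` off `{0}`
(`exponentialPDF_of_nonneg` / `exponentialPDF_of_neg`). [folklore] -/
def sojDensity (lam : ℝ) (u : ℝ) : ℝ≥0∞ := ENNReal.ofReal (lam * Real.exp (-lam * u))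

/-- The density is measurable. [folklore] -/
@[fun_prop]
theorem measurable_sojDensity (lam : ℝ) : Measurable (sojDensity lam) := by
  unfold sojDensity; fun_prop

/-- The exponential law of rate `λ`: **Mathlib's** `ProbabilityTheory.expMeasure λ`
(`= volume.withDensity (exponentialPDF λ)`), under a local name. [folklore] -/
def sojLaw (lam : ℝ) : Measure ℝ := ProbabilityTheory.expMeasure lam

/-- `sojLaw = expMeasure` (unfolding lemma). [folklore] -/
theorem sojLaw_eq_expMeasure (lam : ℝ) : sojLaw lam = ProbabilityTheory.expMeasure lam := rfl

/-- The restricted-density form: `expMeasure λ = (volume on (0,∞)).withDensity (λ e^{-λu})` (the two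
densities differ only at `u = 0`). [folklore] -/
theorem sojLaw_eq_withDensity (lam : ℝ) : sojLaw lam = (volume.restrict (Ioi 0)).withDensity (sojDensity lam) := by
  have h1 : sojLaw lam = volume.withDensity (ProbabilityTheory.exponentialPDF lam) := rfl
  rw [h1, ← withDensity_indicator measurableSet_Ioi]
  refine withDensity_congr_ae ?_
  have hsub : {x : ℝ | ProbabilityTheory.exponentialPDF lam x ≠ (Ioi (0 : ℝ)).indicator (sojDensity lam) x} ⊆ {0} := by
    intro x hx
    rw [Set.mem_singleton_iff]
    by_contra h0
    apply hx
    rcases lt_or_gt_of_ne h0 with h | h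
    · rw [Set.indicator_of_notMem (fun h' : x ∈ Ioi (0 : ℝ) => lt_asymm h h'), ProbabilityTheory.exponentialPDF_of_neg h]
    · rw [Set.indicator_of_mem (show x ∈ Ioi (0 : ℝ) from h), ProbabilityTheory.exponentialPDF_of_nonneg h.le,
        sojDensity, neg_mul]
  rw [Filter.EventuallyEq, ae_iff]
  exact measure_mono_null hsub (measure_singleton 0)

/-- Integrals against the exponential law, as integrals over `(0,∞)` against the density.
[folklore] -/
theorem lintegral_sojLaw (lam : ℝ) {f : ℝ → ℝ≥0∞} (hf : Measurable f) :
    ∫⁻ u, f u ∂(sojLaw lam) = ∫⁻ u in Ioi 0, sojDensity lam u * f u := by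
  rw [sojLaw_eq_withDensity, lintegral_withDensity_eq_lintegral_mul _ (measurable_sojDensity lam) hf]
  rfl

/-- The exponential law is a probability measure for `λ > 0` (Mathlib's
`isProbabilityMeasure_expMeasure`). [folklore] -/
instance isProbabilityMeasure_sojLaw [h : Fact (0 < lam)] : IsProbabilityMeasure (sojLaw lam) :=
  ProbabilityTheory.isProbabilityMeasure_expMeasure h.out

/-- `∫₀^∞ λ e^{-λu} du = 1` for `λ > 0` (total mass, read through `lintegral_sojLaw`). [folklore] -/
theorem lintegral_sojDensity (hlam : 0 < lam) : ∫⁻ u in Ioi 0, sojDensity lam u = 1 := by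
  haveI : Fact (0 < lam) := ⟨hlam⟩
  have h := lintegral_sojLaw lam (f := fun _ => 1) measurable_const
  simp only [lintegral_const, measure_univ, mul_one] at h
  exact h.symm

/-- The exponential law gives no mass to `(-∞, 0]`. [folklore] -/
theorem sojLaw_Iic_zero (lam : ℝ) : sojLaw lam (Iic 0) = 0 := by
  rw [sojLaw_eq_withDensity, withDensity_apply _ measurableSet_Iic, Measure.restrict_restrict measurableSet_Iic,
    Set.Iic_inter_Ioi, Set.Ioc_self, Measure.restrict_empty, lintegral_zero_measure]

/-! ### Sites and configurations -/

/-- The value carried by a site: the step out of the vertex and the sojourn time at it.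
[folklore] -/
abbrev SiteVal (d : ℕ) : Type := SRW.Dir d × ℝ

/-- The site law `unif(Dir d) ⊗ Exp(λ)`. [folklore] -/
def siteLaw (d : ℕ) (lam : ℝ) : Measure (SiteVal d) := (SRW.stepLaw d).prod (sojLaw lam)

/-- The site law is a probability measure (`d ≥ 1`, `λ > 0`). [folklore] -/
instance isProbabilityMeasure_siteLaw [NeZero d] [Fact (0 < lam)] : IsProbabilityMeasure (siteLaw d lam) := by
  unfold siteLaw; infer_instance

/-- Configurations: a site value at every vertex index `i ∈ ℕ`. [folklore] -/
abbrev Config (d : ℕ) : Type := ℕ → SiteVal d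

/-- The law of the site process: i.i.d. sites (`Measure.infinitePi`). [folklore] -/
def configLaw (d : ℕ) (lam : ℝ) [NeZero d] [Fact (0 < lam)] : Measure (Config d) :=
  Measure.infinitePi fun _ : ℕ => siteLaw d lam

/-- The law of the site process is a probability measure. [folklore] -/
instance isProbabilityMeasure_configLaw [NeZero d] [Fact (0 < lam)] :
    IsProbabilityMeasure (configLaw d lam) := by
  unfold configLaw; infer_instance

/-- The directions of a configuration: a path of the simple random walk. [folklore] -/
def dirs (ω : Config d) : SRW.PathSpace d := fun i => (ω i).1

/-- The sojourn time at vertex `i`. [folklore] -/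
def soj (ω : Config d) (i : ℕ) : ℝ := (ω i).2

/-- `dirs` is measurable. [folklore] -/
@[fun_prop]
theorem measurable_dirs : Measurable (dirs : Config d → SRW.PathSpace d) :=
  measurable_pi_lambda _ fun i => (measurable_pi_apply i).fst

/-- Each sojourn is measurable. [folklore] -/
@[fun_prop]
theorem measurable_soj (i : ℕ) : Measurable fun ω : Config d => soj ω i :=
  (measurable_pi_apply i).snd

/-- `dirs` depends on the sites it reads. [folklore] -/
theorem dirs_apply (ω : Config d) (i : ℕ) : dirs ω i = (ω i).1 := rfl

/-! ### Projections -/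

/-- **The first `m` sites are independent with the site law** (`Measure.pi`). [folklore] -/
theorem configLaw_map_restrict [NeZero d] [Fact (0 < lam)] (m : ℕ) :
    (configLaw d lam).map (fun ω (i : Fin m) => ω i) = Measure.pi fun _ : Fin m => siteLaw d lam := by
  unfold configLaw
  rw [Measure.map_infinitePi_infinitePi_of_inj (P := fun _ : ℕ => siteLaw d lam) (f := fun i : Fin m => (i : ℕ))
    Fin.val_injective, Measure.infinitePi_eq_pi]

/-- Integrals of functions of the first `m` sites. [folklore] -/
theorem lintegral_comp_restrict [NeZero d] [Fact (0 < lam)] (m : ℕ) {F : (Fin m → SiteVal d) → ℝ≥0∞}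
    (hF : Measurable F) :
    ∫⁻ ω, F (fun i : Fin m => ω i) ∂(configLaw d lam) = ∫⁻ z, F z ∂(Measure.pi fun _ : Fin m => siteLaw d lam) := by
  rw [← configLaw_map_restrict m,
    lintegral_map hF (measurable_pi_lambda (fun (ω : Config d) (i : Fin m) => ω i) fun i => measurable_pi_apply (i : ℕ))]

/-- **The directions form a simple random walk**: `dirs` pushes the site process to `SRW.pathLaw`.
[folklore] -/
theorem configLaw_map_dirs [NeZero d] [Fact (0 < lam)] :
    (configLaw d lam).map dirs = SRW.pathLaw d := by
  unfold configLaw SRW.pathLaw dirs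
  rw [Measure.infinitePi_map_pi (μ := fun _ : ℕ => siteLaw d lam) (f := fun _ (z : SiteVal d) => z.1)
    (fun _ => measurable_fst)]
  congr 1
  funext i
  unfold siteLaw
  rw [Measure.map_fst_prod, measure_univ, one_smul]

/-- Probabilities of direction events are simple-random-walk probabilities. [folklore] -/
theorem configLaw_real_preimage_dirs [NeZero d] [Fact (0 < lam)] {E : Set (SRW.PathSpace d)}
    (hE : MeasurableSet E) : (configLaw d lam).real (dirs ⁻¹' E) = (SRW.pathLaw d).real E := by
  rw [measureReal_def, measureReal_def, ← Measure.map_apply measurable_dirs hE, configLaw_map_dirs]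

/-- Integrals of functions of the directions. [folklore] -/
theorem lintegral_comp_dirs [NeZero d] [Fact (0 < lam)] {f : SRW.PathSpace d → ℝ≥0∞} (hf : Measurable f) :
    ∫⁻ ω, f (dirs ω) ∂(configLaw d lam) = ∫⁻ p, f p ∂(SRW.pathLaw d) := by
  rw [← configLaw_map_dirs (lam := lam), lintegral_map hf measurable_dirs]

/-! ### Shift invariance -/

/-- The shift of a configuration by `m` sites. [folklore] -/
def shift (m : ℕ) (ω : Config d) : Config d := fun i => ω (i + m)

/-- The shift is measurable. [folklore] -/
@[fun_prop]
theorem measurable_shift (m : ℕ) : Measurable (shift (d := d) m) :=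
  measurable_pi_lambda _ fun _ => measurable_pi_apply _

/-- **Shift invariance** of the i.i.d. site process. [folklore] -/
theorem configLaw_map_shift [NeZero d] [Fact (0 < lam)] (m : ℕ) :
    (configLaw d lam).map (shift m) = configLaw d lam := by
  unfold configLaw shift
  exact Measure.map_infinitePi_infinitePi_of_inj (P := fun _ : ℕ => siteLaw d lam) (f := fun i : ℕ => i + m)
    (add_left_injective m)

/-- Integrals are invariant under the shift. [folklore] -/
theorem lintegral_comp_shift [NeZero d] [Fact (0 < lam)] (m : ℕ) {F : Config d → ℝ≥0∞} (hF : Measurable F) :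
    ∫⁻ ω, F (shift m ω) ∂(configLaw d lam) = ∫⁻ ω, F ω ∂(configLaw d lam) := by
  conv_rhs => rw [← configLaw_map_shift (lam := lam) m]
  rw [lintegral_map hF (measurable_shift m)]

/-! ### Independence of disjoint blocks of sites -/

/-- Under the site process, the coordinates are independent. [folklore] -/
theorem iIndepFun_coord [NeZero d] [Fact (0 < lam)] :
    iIndepFun (fun (i : ℕ) (ω : Config d) => ω i) (configLaw d lam) :=
  iIndepFun_infinitePi (P := fun _ : ℕ => siteLaw d lam) (X := fun _ (z : SiteVal d) => z) fun _ => measurable_id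

/-- A measurable function depending only on the coordinates in a finite set factors measurably
through the restriction to that set. [folklore] -/
theorem exists_measurable_factor {I : Finset ℕ} {f : Config d → ℝ≥0∞} (hf : Measurable f)
    (hfI : DependsOn f (I : Set ℕ)) (ω₀ : Config d) :
    ∃ f' : (I → SiteVal d) → ℝ≥0∞, Measurable f' ∧ f = f' ∘ fun ω (i : I) => ω i := by
  classical
  refine ⟨fun z => f (Function.updateFinset ω₀ I z), hf.comp measurable_updateFinset, ?_⟩
  funext ω
  simp only [Function.comp_apply]
  refine hfI fun i hi => ?_
  simp [Function.updateFinset, Finset.mem_coe.1 hi]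

/-- **Functions of disjoint blocks of sites are independent**: the integral of the product is the
product of the integrals. [folklore] -/
theorem lintegral_mul_eq_of_dependsOn [NeZero d] [Fact (0 < lam)] {I J : Finset ℕ} (hIJ : Disjoint I J)
    {f g : Config d → ℝ≥0∞} (hf : Measurable f) (hg : Measurable g)
    (hfI : DependsOn f (I : Set ℕ)) (hgJ : DependsOn g (J : Set ℕ)) :
    ∫⁻ ω, f ω * g ω ∂(configLaw d lam) = (∫⁻ ω, f ω ∂(configLaw d lam)) * ∫⁻ ω, g ω ∂(configLaw d lam) := by
  obtain ⟨ω₀⟩ : Nonempty (Config d) := inferInstance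
  obtain ⟨f', hf'm, hff'⟩ := exists_measurable_factor hf hfI ω₀
  obtain ⟨g', hg'm, hgg'⟩ := exists_measurable_factor hg hgJ ω₀
  have hind : IndepFun (fun (ω : Config d) (i : I) => ω i) (fun (ω : Config d) (i : J) => ω i) (configLaw d lam) :=
    iIndepFun_coord.indepFun_finset I J hIJ fun i => measurable_pi_apply i
  have hind' : IndepFun f g (configLaw d lam) := by
    rw [hff', hgg']
    exact hind.comp hf'm hg'm
  exact lintegral_mul_eq_lintegral_mul_lintegral_of_indepFun'' hf.aemeasurable hg.aemeasurable hind'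

/-- `DependsOn` is preserved by post-composition. [folklore] -/
theorem dependsOn_comp {α β : Type*} {F : Config d → α} {I : Set ℕ} (hF : DependsOn F I) (φ : α → β) :
    DependsOn (fun ω => φ (F ω)) I := fun _ _ h => congrArg φ (hF h)

/-- A function read through the shift by `m` depends on the shifted coordinate set. [folklore] -/
theorem dependsOn_comp_shift {α : Type*} {F : Config d → α} {n : ℕ} (hF : DependsOn F (Finset.range n : Set ℕ))
    (m : ℕ) : DependsOn (fun ω => F (shift m ω)) (Finset.Ico m (m + n) : Set ℕ) := by
  intro ω ω' h
  refine hF fun i hi => ?_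
  simp only [shift]
  refine h (i + m) ?_
  simp only [Finset.coe_Ico, Set.mem_Ico, Finset.coe_range, Set.mem_Iio] at hi ⊢
  omega

/-! ### Almost sure positivity of the sojourns -/

/-- Each site has the site law. [folklore] -/
theorem configLaw_map_eval [NeZero d] [Fact (0 < lam)] (i : ℕ) :
    (configLaw d lam).map (fun ω => ω i) = siteLaw d lam := by
  unfold configLaw
  exact Measure.infinitePi_map_eval (fun _ : ℕ => siteLaw d lam) i

/-- The sojourn at a given vertex is almost surely positive. [folklore] -/
theorem ae_soj_pos [NeZero d] [Fact (0 < lam)] (i : ℕ) : ∀ᵐ ω ∂(configLaw d lam), 0 < soj ω i := by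
  rw [ae_iff]
  have hset : {ω : Config d | ¬ 0 < soj ω i} = (fun ω => ω i) ⁻¹' (Set.univ ×ˢ Iic (0 : ℝ)) := by
    ext ω; simp [soj, not_lt]
  rw [hset, ← Measure.map_apply (measurable_pi_apply i) (MeasurableSet.univ.prod measurableSet_Iic),
    configLaw_map_eval, siteLaw, Measure.prod_prod, sojLaw_Iic_zero, mul_zero]

/-- **All sojourns are almost surely positive.** [folklore] -/
theorem ae_forall_soj_pos [NeZero d] [Fact (0 < lam)] : ∀ᵐ ω ∂(configLaw d lam), ∀ i, 0 < soj ω i :=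
  ae_all_iff.2 ae_soj_pos

end Literature.Barriers.CriticalPhenomena.CTWSAW
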